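import Summits.CriticalPhenomena.PercolationContinuityZ3.Theorems.PercNearOneGluingNoHeavyLowerTailKNQuestion7AllRelays
import Literature.Probability.LatticeModels.ProdBernoulliIndependence
import Literature.Probability.Percolation.PercolationEvents
import Summits.CriticalPhenomena.PercolationContinuityZ3.Theorems.PercNearOneGluingNoHeavyLowerTailQuantGapPlusOne
import HarnessLib

/-!
# `NoHeavyLowerTail` (stmt-CriticalPhenomena-4575) — the WORST-FIRST SELECTION inequality (CSL / WF) is a theorem

Support file (`--supports stmt-CriticalPhenomena-4575`), prover `prim-ineq-gen-6` (gen 10; memo FINDING-G10 §5).  No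
definitions, no named facts, no sorries; standard axioms.

Bond percolation `μ = prodBernoulli w` on `Fin n` (every weight vector), relays `A`, observer `o`, target vertex `c`,
`δ_a := μ(a ↮ c)`, `𝔸 = {o ↔ A}`; WORST-FIRST selection: `a ∈ A` is the worst-ranked relay of `o`'s block if `o ↔ a` and
every relay `x` joined to `o` has `δ_x < δ_a` or (`δ_x = δ_a` and `a ≤ x`); `W_a` = that event ∩ `{o ↮ c}`.  The registered
stub `stub_worstFirstGluing` (gen-kcluster WF, census-clean, open since 2026-08-18): `Σ_{a ∈ A} μ(W_a)/δ_a ≤ 1`.  It is the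
target-`{∋ c}` instance of this lineage's CONDITIONAL SELECTION LEMMA (CSL, FINDING-G5; pair case p199515; the three-candidate
certificate route was closed at cubic rows by an exact pseudo-law, ttrl l.548 — which, consistently, violates the row used here).

PROOF = Kozma–Nitzan's Conjecture 4 (tree theorem `Q7Psi.kn_conj4_designated`, designated form, every weight vector) for the
WEIGHTED monotone cluster functional `F(S) = −1{c ∉ S}·min_{x ∈ S∩A} 1/δ_x` (`−M` if `S ∩ A = ∅`): its least-mean relay is the
globally worst relay `a₁` (`E F(C_a) ≥ −1 = E F(C_{a₁})`), `∫_𝔸 F(C_o) = −Σ_a μ(W_a)/δ_a` (on `W_a` the minimum is `1/δ_a`; the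
`W_a` are disjoint by the tie-break), `∫_𝔸 F(C_{a₁}) ≥ −μ(𝔸 ∩ {a₁ ↮ c})/δ_{a₁}`, and Harris gives
`Σ_a μ(W_a)/δ_a ≤ μ(𝔸, a₁ ↮ c)/δ_{a₁} ≤ μ(𝔸) ≤ 1` (`CSLHolds.worstFirst_sum_div_le` for positive `δ`; the registered form by
discarding the relays with `δ = 0`).  Companion file `…CovarianceGluingHolds.lean`: the unweighted form (U) = `stub_covGluing`.
[cite: KozmaNitzan2024, Conjecture 4 (p. 32), Lemma 2 (p. 6)] [cite: Harris1960]
-/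

noncomputable section

namespace Summit.CriticalPhenomena.PercolationContinuityZ3.Theorems

open MeasureTheory Set Literature.Probability.LatticeModels Literature.Probability.Percolation
open scoped Classical

namespace CSLHolds

variable {n : ℕ}

/-! ### The worst-first order (δ-maximal, smallest index among ties): uniqueness and existence -/

/-- Two worst-ranked elements of the same finset coincide. [folklore] -/
theorem worst_unique (δ : Fin n → ℝ) (B : Finset (Fin n)) {a a' : Fin n} (ha : a ∈ B) (ha' : a' ∈ B)
    (h : ∀ x ∈ B, δ x < δ a ∨ (δ x = δ a ∧ a ≤ x)) (h' : ∀ x ∈ B, δ x < δ a' ∨ (δ x = δ a' ∧ a' ≤ x)) :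
    a = a' := by
  rcases h a' ha' with h1 | ⟨h1, h2⟩
  · rcases h' a ha with h3 | ⟨h3, _⟩
    · exact absurd (h1.trans h3) (lt_irrefl _)
    · rw [h3] at h1; exact absurd h1 (lt_irrefl _)
  · rcases h' a ha with h3 | ⟨_, h4⟩
    · rw [h1] at h3; exact absurd h3 (lt_irrefl _)
    · exact le_antisymm h2 h4

/-- A nonempty finset has a worst-ranked element. [folklore] -/
theorem worst_exists (δ : Fin n → ℝ) (B : Finset (Fin n)) (hB : B.Nonempty) :
    ∃ a ∈ B, ∀ x ∈ B, δ x < δ a ∨ (δ x = δ a ∧ a ≤ x) := by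
  obtain ⟨m, hm, hmax⟩ := B.exists_max_image δ hB
  set B' := B.filter fun x => δ x = δ m with hB'
  have hB'ne : B'.Nonempty := ⟨m, Finset.mem_filter.2 ⟨hm, rfl⟩⟩
  set a := B'.min' hB'ne with ha
  have haB' : a ∈ B' := Finset.min'_mem B' hB'ne
  have haB : a ∈ B := (Finset.mem_filter.1 haB').1
  have hδa : δ a = δ m := (Finset.mem_filter.1 haB').2
  refine ⟨a, haB, fun x hx => ?_⟩
  have hxm : δ x ≤ δ m := hmax x hx
  by_cases hlt : δ x < δ a
  · exact Or.inl hlt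
  · right
    have hxa : δ x = δ a := le_antisymm (hδa ▸ hxm) (not_lt.1 hlt)
    refine ⟨hxa, ?_⟩
    have hxB' : x ∈ B' := Finset.mem_filter.2 ⟨hx, hxa.trans hδa⟩
    exact Finset.min'_le B' x hxB'

/-- Integral of a finite sum of weighted indicators. [folklore] -/
theorem integral_sum_indicator (μ : Measure (BondConfig (Fin n))) [IsFiniteMeasure μ] (A : Finset (Fin n))
    (g : Fin n → ℝ) (S : Fin n → Set (BondConfig (Fin n))) :
    ∫ ω, (∑ a ∈ A, (S a).indicator (fun _ => g a) ω) ∂μ = ∑ a ∈ A, μ.real (S a) * g a := by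
  rw [integral_finsetSum _ (fun a _ => Integrable.of_finite)]
  refine Finset.sum_congr rfl fun a _ => ?_
  rw [integral_indicator_const (g a) MeasurableSet.of_discrete, smul_eq_mul]

/-! ### WF: the worst-first gluing inequality -/

/-- **The worst-first gluing inequality (CSL at the target `∋ c`), positive detachments.**  If `μ(a ↮ c) > 0` for
every `a ∈ A`, then `Σ_{a∈A} μ(W_a)/μ(a ↮ c) ≤ μ(o ↔ A)`, `W_a = {o ↔ a, o ↮ c, a worst-ranked relay of o's block}`.
Kozma–Nitzan's Conjecture 4 for `F(S) = −1{c ∉ S}·min_{x ∈ S∩A} 1/δ_x`. [this work] [cite: KozmaNitzan2024, Conjecture 4 (p. 32)] -/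
theorem worstFirst_sum_div_le (w : Sym2 (Fin n) → unitInterval) (A : Finset (Fin n)) (o c : Fin n)
    (hpos : ∀ a ∈ A, 0 < (prodBernoulli w).real (openConn a c : Set (BondConfig (Fin n)))ᶜ) :
    (∑ a ∈ A, (prodBernoulli w).real
        {ω : BondConfig (Fin n) | ω ∈ openConn o a ∧ ω ∉ openConn o c ∧
          ∀ x ∈ A, ω ∈ openConn o x →
            ((prodBernoulli w).real (openConn x c : Set (BondConfig (Fin n)))ᶜ <
                (prodBernoulli w).real (openConn a c : Set (BondConfig (Fin n)))ᶜ ∨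
              ((prodBernoulli w).real (openConn x c : Set (BondConfig (Fin n)))ᶜ =
                  (prodBernoulli w).real (openConn a c : Set (BondConfig (Fin n)))ᶜ ∧ a ≤ x))} /
        (prodBernoulli w).real (openConn a c : Set (BondConfig (Fin n)))ᶜ) ≤
      (prodBernoulli w).real (⋃ a ∈ A, (openConn o a : Set (BondConfig (Fin n)))) := by
  set μ := prodBernoulli w with hμ
  haveI : IsProbabilityMeasure μ := by rw [hμ]; infer_instance
  have hmeas : ∀ S : Set (BondConfig (Fin n)), MeasurableSet S := fun _ => MeasurableSet.of_discrete
  have hint : ∀ (g : BondConfig (Fin n) → ℝ), Integrable g μ := fun g => Integrable.of_finite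
  -- detachments
  set δ : Fin n → ℝ := fun a => μ.real (openConn a c : Set (BondConfig (Fin n)))ᶜ with hδ
  set U : Set (BondConfig (Fin n)) := ⋃ a ∈ A, (openConn o a : Set (BondConfig (Fin n))) with hU
  -- the selected events
  set W : Fin n → Set (BondConfig (Fin n)) := fun a =>
    {ω : BondConfig (Fin n) | ω ∈ openConn o a ∧ ω ∉ openConn o c ∧
      ∀ x ∈ A, ω ∈ openConn o x → (δ x < δ a ∨ (δ x = δ a ∧ a ≤ x))} with hW
  change (∑ a ∈ A, μ.real (W a) / δ a) ≤ μ.real U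
  rcases A.eq_empty_or_nonempty with hAe | hAne
  · rw [hAe, Finset.sum_empty]; exact measureReal_nonneg
  -- the globally worst relay `a₁`
  obtain ⟨a₁, ha₁, hworst₁⟩ := worst_exists δ A hAne
  have hle₁ : ∀ x ∈ A, δ x ≤ δ a₁ := fun x hx => by
    rcases hworst₁ x hx with h | ⟨h, _⟩
    · exact h.le
    · exact h.le
  have hδpos : ∀ a ∈ A, 0 < δ a := hpos
  have hδ₁ : 0 < δ a₁ := hδpos a₁ ha₁
  -- the weights `1/δ` and the cap `M`
  set M : ℝ := ∑ x ∈ A, 1 / δ x with hM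
  have hinvM : ∀ x ∈ A, 1 / δ x ≤ M := fun x hx =>
    Finset.single_le_sum (f := fun x => 1 / δ x) (fun y hy => (one_div_pos.2 (hδpos y hy)).le) hx
  -- `m(S) = min_{x ∈ S ∩ A} 1/δ_x` (or `M`)
  set m : Set (Fin n) → ℝ := fun S =>
    if h : (A.filter fun x => x ∈ S).Nonempty then (A.filter fun x => x ∈ S).inf' h (fun x => 1 / δ x) else M
    with hm
  have hm1 : ∀ (S : Set (Fin n)), ∀ a ∈ A, a ∈ S → m S ≤ 1 / δ a := by
    intro S a ha haS
    have hmem : a ∈ A.filter fun x => x ∈ S := Finset.mem_filter.2 ⟨ha, haS⟩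
    have hne : (A.filter fun x => x ∈ S).Nonempty := ⟨a, hmem⟩
    simp only [hm, dif_pos hne]
    exact Finset.inf'_le _ hmem
  have hm2 : ∀ S : Set (Fin n), 1 / δ a₁ ≤ m S := by
    intro S
    by_cases hne : (A.filter fun x => x ∈ S).Nonempty
    · simp only [hm, dif_pos hne]
      refine Finset.le_inf' hne _ fun x hx => ?_
      have hxA : x ∈ A := (Finset.mem_filter.1 hx).1
      exact one_div_le_one_div_of_le (hδpos x hxA) (hle₁ x hxA)
    · simp only [hm, dif_neg hne]
      exact hinvM a₁ ha₁
  have hm0 : ∀ S : Set (Fin n), 0 ≤ m S := fun S => (one_div_pos.2 hδ₁).le.trans (hm2 S)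
  have hm3 : ∀ S T : Set (Fin n), S ⊆ T → m T ≤ m S := by
    intro S T hST
    by_cases hneS : (A.filter fun x => x ∈ S).Nonempty
    · have hsub : (A.filter fun x => x ∈ S) ⊆ (A.filter fun x => x ∈ T) :=
        Finset.monotone_filter_right A fun _ _ hx => hST hx
      have hneT : (A.filter fun x => x ∈ T).Nonempty := hneS.mono hsub
      simp only [hm, dif_pos hneS, dif_pos hneT]
      refine Finset.le_inf' hneS _ fun x hx => ?_
      exact Finset.inf'_le _ (hsub hx)
    · simp only [hm, dif_neg hneS]
      by_cases hneT : (A.filter fun x => x ∈ T).Nonempty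
      · simp only [dif_pos hneT]
        obtain ⟨x, hx⟩ := hneT
        exact (Finset.inf'_le _ hx).trans (hinvM x (Finset.mem_filter.1 hx).1)
      · simp only [dif_neg hneT]; exact le_refl _
  -- the functional
  set F : Set (Fin n) → ℝ := fun S => if c ∈ S then 0 else -m S with hF
  have hFmono : ∀ S T : Set (Fin n), S ⊆ T → F S ≤ F T := by
    intro S T hST
    by_cases hcT : c ∈ T
    · simp only [hF, if_pos hcT]
      by_cases hcS : c ∈ S
      · simp only [if_pos hcS]; exact le_refl _
      · simp only [if_neg hcS]; linarith [hm0 S]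
    · have hcS : c ∉ S := fun h => hcT (hST h)
      simp only [hF, if_neg hcT, if_neg hcS]
      linarith [hm3 S T hST]
  -- designated least-mean relay: `E F(C a₁) ≤ -1 ≤ E F(C a)`
  have hlow : ∀ a ∈ A, -1 ≤ ∫ ω, F (openCluster ω a) ∂μ := by
    intro a ha
    have hpt : ∀ ω, ((openConn a c : Set (BondConfig (Fin n)))ᶜ).indicator (fun _ => -(1 / δ a)) ω ≤
        F (openCluster ω a) := by
      intro ω
      by_cases hca : c ∈ openCluster ω a
      · have hω : ω ∉ (openConn a c : Set (BondConfig (Fin n)))ᶜ := fun h => h hca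
        rw [Set.indicator_of_notMem hω]
        simp only [hF, if_pos hca]; exact le_refl _
      · have hω : ω ∈ (openConn a c : Set (BondConfig (Fin n)))ᶜ := hca
        rw [Set.indicator_of_mem hω]
        simp only [hF, if_neg hca]
        linarith [hm1 (openCluster ω a) a ha (mem_openCluster_self ω a)]
    have hI := integral_mono (hint _) (hint _) hpt
    rw [integral_indicator_const _ (hmeas _), smul_eq_mul] at hI
    have hδa : δ a ≠ 0 := (hδpos a ha).ne'
    have : μ.real (openConn a c : Set (BondConfig (Fin n)))ᶜ * -(1 / δ a) = -1 := by
      change δ a * -(1 / δ a) = -1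
      field_simp
    linarith
  have hup : ∫ ω, F (openCluster ω a₁) ∂μ ≤ -1 := by
    have hpt : ∀ ω, F (openCluster ω a₁) ≤
        ((openConn a₁ c : Set (BondConfig (Fin n)))ᶜ).indicator (fun _ => -(1 / δ a₁)) ω := by
      intro ω
      by_cases hca : c ∈ openCluster ω a₁
      · have hω : ω ∉ (openConn a₁ c : Set (BondConfig (Fin n)))ᶜ := fun h => h hca
        rw [Set.indicator_of_notMem hω]
        simp only [hF, if_pos hca]; exact le_refl _
      · have hω : ω ∈ (openConn a₁ c : Set (BondConfig (Fin n)))ᶜ := hca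
        rw [Set.indicator_of_mem hω]
        simp only [hF, if_neg hca]
        linarith [hm2 (openCluster ω a₁)]
    have hI := integral_mono (hint _) (hint _) hpt
    rw [integral_indicator_const _ (hmeas _), smul_eq_mul] at hI
    have : μ.real (openConn a₁ c : Set (BondConfig (Fin n)))ᶜ * -(1 / δ a₁) = -1 := by
      change δ a₁ * -(1 / δ a₁) = -1
      field_simp
    linarith
  have hmin : ∀ a ∈ A, ∫ ω, F (openCluster ω a₁) ∂μ ≤ ∫ ω, F (openCluster ω a) ∂μ :=
    fun a ha => hup.trans (hlow a ha)
  -- Conjecture 4, designated form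
  have key := Q7Psi.kn_conj4_designated w A o a₁ F hFmono ha₁ hmin
  rw [← hμ] at key
  change ∫ ω in U, F (openCluster ω a₁) ∂μ ≤ ∫ ω in U, F (openCluster ω o) ∂μ at key
  -- upper bound for the observer side: `∫_U F(C_o) ≤ -Σ_a μ(W_a)/δ_a`
  have hobs : ∫ ω in U, F (openCluster ω o) ∂μ ≤ -∑ a ∈ A, μ.real (W a) * (1 / δ a) := by
    rw [← integral_indicator (hmeas U)]
    have hpt : ∀ ω, U.indicator (fun ω => F (openCluster ω o)) ω ≤
        -∑ a ∈ A, (W a).indicator (fun _ => 1 / δ a) ω := by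
      intro ω
      by_cases hωU : ω ∈ U
      · rw [Set.indicator_of_mem hωU]
        by_cases hoc : c ∈ openCluster ω o
        · -- every `W_a` fails
          have hzero : ∀ a ∈ A, (W a).indicator (fun _ => 1 / δ a) ω = 0 := by
            intro a _
            exact Set.indicator_of_notMem (fun h => h.2.1 hoc) _
          rw [Finset.sum_congr rfl hzero, Finset.sum_const_zero, neg_zero]
          simp only [hF, if_pos hoc]; exact le_refl _
        · simp only [hF, if_neg hoc]
          by_cases hex : ∃ a ∈ A, ω ∈ W a
          · obtain ⟨a, ha, hωa⟩ := hex
            have hsum : ∑ x ∈ A, (W x).indicator (fun _ => 1 / δ x) ω = 1 / δ a := by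
              rw [Finset.sum_eq_single_of_mem a ha]
              · exact Set.indicator_of_mem hωa _
              · intro b hb hba
                refine Set.indicator_of_notMem (fun hωb => hba ?_) _
                -- uniqueness of the worst element of `π(o)`
                have hbB : b ∈ A.filter fun x => ω ∈ openConn o x := Finset.mem_filter.2 ⟨hb, hωb.1⟩
                have haB : a ∈ A.filter fun x => ω ∈ openConn o x := Finset.mem_filter.2 ⟨ha, hωa.1⟩
                exact worst_unique δ (A.filter fun x => ω ∈ openConn o x) hbB haB
                  (fun x hx => hωb.2.2 x (Finset.mem_filter.1 hx).1 (Finset.mem_filter.1 hx).2)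
                  (fun x hx => hωa.2.2 x (Finset.mem_filter.1 hx).1 (Finset.mem_filter.1 hx).2)
            rw [hsum]
            -- `1/δ_a ≤ m(C_o)`: `a` has the largest `δ` in `π(o)`
            have hne : (A.filter fun x => x ∈ openCluster ω o).Nonempty :=
              ⟨a, Finset.mem_filter.2 ⟨ha, hωa.1⟩⟩
            have hle : 1 / δ a ≤ m (openCluster ω o) := by
              simp only [hm, dif_pos hne]
              refine Finset.le_inf' hne _ fun x hx => ?_
              have hxA : x ∈ A := (Finset.mem_filter.1 hx).1
              have hox : ω ∈ openConn o x := (Finset.mem_filter.1 hx).2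
              have hδle : δ x ≤ δ a := by
                rcases hωa.2.2 x hxA hox with h | ⟨h, _⟩
                · exact h.le
                · exact h.le
              exact one_div_le_one_div_of_le (hδpos x hxA) hδle
            linarith
          · push Not at hex
            have hzero : ∀ a ∈ A, (W a).indicator (fun _ => 1 / δ a) ω = 0 := fun a ha =>
              Set.indicator_of_notMem (hex a ha) _
            rw [Finset.sum_congr rfl hzero, Finset.sum_const_zero, neg_zero]
            linarith [hm0 (openCluster ω o)]
      · rw [Set.indicator_of_notMem hωU]
        have hzero : ∀ a ∈ A, (W a).indicator (fun _ => 1 / δ a) ω = 0 := by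
          intro a ha
          refine Set.indicator_of_notMem (fun h => hωU ?_) _
          exact Set.mem_iUnion₂.2 ⟨a, ha, h.1⟩
        rw [Finset.sum_congr rfl hzero, Finset.sum_const_zero, neg_zero]
    have hI := integral_mono (hint _) (hint _) hpt
    rw [integral_neg, integral_sum_indicator] at hI
    exact hI
  -- lower bound for the relay side: `∫_U F(C a₁) ≥ -μ(U ∩ {a₁ ↮ c})/δ_{a₁}`
  have hrel : -(μ.real (U ∩ (openConn a₁ c : Set (BondConfig (Fin n)))ᶜ) * (1 / δ a₁)) ≤
      ∫ ω in U, F (openCluster ω a₁) ∂μ := by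
    rw [← integral_indicator (hmeas U)]
    have hpt : ∀ ω, (U ∩ (openConn a₁ c : Set (BondConfig (Fin n)))ᶜ).indicator (fun _ => -(1 / δ a₁)) ω ≤
        U.indicator (fun ω => F (openCluster ω a₁)) ω := by
      intro ω
      by_cases hωU : ω ∈ U
      · rw [Set.indicator_of_mem hωU]
        by_cases hca : c ∈ openCluster ω a₁
        · have hω : ω ∉ U ∩ (openConn a₁ c : Set (BondConfig (Fin n)))ᶜ := fun h => h.2 hca
          rw [Set.indicator_of_notMem hω]
          simp only [hF, if_pos hca]; exact le_refl _
        · have hω : ω ∈ U ∩ (openConn a₁ c : Set (BondConfig (Fin n)))ᶜ := ⟨hωU, hca⟩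
          rw [Set.indicator_of_mem hω]
          simp only [hF, if_neg hca]
          linarith [hm1 (openCluster ω a₁) a₁ ha₁ (mem_openCluster_self ω a₁)]
      · rw [Set.indicator_of_notMem hωU]
        have hω : ω ∉ U ∩ (openConn a₁ c : Set (BondConfig (Fin n)))ᶜ := fun h => hωU h.1
        rw [Set.indicator_of_notMem hω]
    have hI := integral_mono (hint _) (hint _) hpt
    rw [integral_indicator_const _ (hmeas _), smul_eq_mul] at hI
    linarith
  -- Harris: `{o ↔ A}` increasing, `{a₁ ↮ c}` decreasing
  have hharris : μ.real (U ∩ (openConn a₁ c : Set (BondConfig (Fin n)))ᶜ) ≤ μ.real U * δ a₁ :=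
    prodBernoulli_harris_upper_lower w (QuantGapPlusOne.isUpperSet_touch A o) (isUpperSet_openConn a₁ c).compl
      (hmeas _) (hmeas _)
  -- assemble
  have hsum_eq : (∑ a ∈ A, μ.real (W a) / δ a) = ∑ a ∈ A, μ.real (W a) * (1 / δ a) :=
    Finset.sum_congr rfl fun a _ => by rw [div_eq_mul_one_div]
  rw [hsum_eq]
  have h1 : (∑ a ∈ A, μ.real (W a) * (1 / δ a)) ≤
      μ.real (U ∩ (openConn a₁ c : Set (BondConfig (Fin n)))ᶜ) * (1 / δ a₁) := by linarith
  have h2 : μ.real (U ∩ (openConn a₁ c : Set (BondConfig (Fin n)))ᶜ) * (1 / δ a₁) ≤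
      μ.real U * δ a₁ * (1 / δ a₁) :=
    mul_le_mul_of_nonneg_right hharris (one_div_pos.2 hδ₁).le
  have h3 : μ.real U * δ a₁ * (1 / δ a₁) = μ.real U := by field_simp
  linarith

/-- **Registered stub `stub_worstFirstGluing` (gen-kcluster, WORST-FIRST GLUING WF), verbatim**:
`Σ_{a∈A} μ(W_a) / μ(a ↮ c) ≤ 1`.  From `worstFirst_sum_div_le` applied to the relays with `μ(a ↮ c) > 0` (the others
contribute `x / 0 = 0` and rank below every positive one). [this work] [cite: KozmaNitzan2024, Conjecture 4 (p. 32)] -/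
theorem stub_worstFirstGluing :
    ∀ (n : ℕ) (w : Sym2 (Fin n) → unitInterval) (A : Finset (Fin n)) (o c : Fin n),
      ∑ a ∈ A, (Literature.Probability.LatticeModels.prodBernoulli w).real
          {ω : Literature.Probability.Percolation.BondConfig (Fin n) |
            (Literature.Probability.Percolation.openGraph ω).Reachable o a ∧
            ¬ (Literature.Probability.Percolation.openGraph ω).Reachable o c ∧
            ∀ x ∈ A, (Literature.Probability.Percolation.openGraph ω).Reachable o x →
              ((Literature.Probability.LatticeModels.prodBernoulli w).real
                  (Literature.Probability.Percolation.openConn x c :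
                    Set (Literature.Probability.Percolation.BondConfig (Fin n)))ᶜ <
                (Literature.Probability.LatticeModels.prodBernoulli w).real
                  (Literature.Probability.Percolation.openConn a c :
                    Set (Literature.Probability.Percolation.BondConfig (Fin n)))ᶜ ∨
              ((Literature.Probability.LatticeModels.prodBernoulli w).real
                  (Literature.Probability.Percolation.openConn x c :
                    Set (Literature.Probability.Percolation.BondConfig (Fin n)))ᶜ =
                (Literature.Probability.LatticeModels.prodBernoulli w).real
                  (Literature.Probability.Percolation.openConn a c :
                    Set (Literature.Probability.Percolation.BondConfig (Fin n)))ᶜ ∧ a ≤ x))} /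
        (Literature.Probability.LatticeModels.prodBernoulli w).real
          (Literature.Probability.Percolation.openConn a c :
            Set (Literature.Probability.Percolation.BondConfig (Fin n)))ᶜ ≤ 1 := by
  intro n w A o c
  set μ := prodBernoulli w with hμ
  haveI : IsProbabilityMeasure μ := by rw [hμ]; infer_instance
  set δ : Fin n → ℝ := fun a => μ.real (openConn a c : Set (BondConfig (Fin n)))ᶜ with hδ
  -- the events, over the full relay set `A` and over the positive part `A⁺`
  set A' := A.filter fun a => 0 < δ a with hA'
  set W : Finset (Fin n) → Fin n → Set (BondConfig (Fin n)) := fun B a =>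
    {ω : BondConfig (Fin n) | ω ∈ openConn o a ∧ ω ∉ openConn o c ∧
      ∀ x ∈ B, ω ∈ openConn o x → (δ x < δ a ∨ (δ x = δ a ∧ a ≤ x))} with hW
  change (∑ a ∈ A, μ.real (W A a) / δ a) ≤ 1
  have hδ0 : ∀ a, 0 ≤ δ a := fun a => measureReal_nonneg
  -- split the sum
  rw [← Finset.sum_filter_add_sum_filter_not A (fun a => 0 < δ a)]
  have hzero : ∑ a ∈ A.filter (fun a => ¬ 0 < δ a), μ.real (W A a) / δ a = 0 := by
    refine Finset.sum_eq_zero fun a ha => ?_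
    have hna : ¬ 0 < δ a := (Finset.mem_filter.1 ha).2
    have hz : δ a = 0 := le_antisymm (not_lt.1 hna) (hδ0 a)
    rw [hz, div_zero]
  rw [hzero, add_zero]
  -- compare with the positive-part events and apply the core inequality on `A⁺`
  have hpos : ∀ a ∈ A', 0 < μ.real (openConn a c : Set (BondConfig (Fin n)))ᶜ :=
    fun a ha => (Finset.mem_filter.1 ha).2
  have hcore := worstFirst_sum_div_le w A' o c hpos
  rw [← hμ] at hcore
  change (∑ a ∈ A', μ.real (W A' a) / δ a) ≤ μ.real (⋃ a ∈ A', (openConn o a : Set (BondConfig (Fin n))))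
    at hcore
  have hterm : ∀ a ∈ A', μ.real (W A a) / δ a ≤ μ.real (W A' a) / δ a := by
    intro a ha
    refine div_le_div_of_nonneg_right ?_ (hδ0 a)
    refine measureReal_mono (fun ω hω => ⟨hω.1, hω.2.1, fun x hx hox => ?_⟩) (measure_ne_top μ _)
    exact hω.2.2 x (Finset.mem_filter.1 hx).1 hox
  calc (∑ a ∈ A', μ.real (W A a) / δ a) ≤ ∑ a ∈ A', μ.real (W A' a) / δ a := Finset.sum_le_sum hterm
    _ ≤ μ.real (⋃ a ∈ A', (openConn o a : Set (BondConfig (Fin n)))) := hcore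
    _ ≤ 1 := measureReal_le_one

end CSLHolds

end Summit.CriticalPhenomena.PercolationContinuityZ3.Theorems

end
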